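import Summits.AnomalousDissipation.AnomalousDissipation.Theorems.SawtoothPulseCascadeK1LocalisedCascadeFlatAffine
import Summits.AnomalousDissipation.AnomalousDissipation.Theorems.SawtoothPulseCascadeK1LocalisedCascadeZoneMeasure

/-!
# K1loc, line `Spectral` — S-D (first good piece): THE FLAT COMPONENTS OF THE CASCADE PROFILE

Helper file of the prover lane on the crux `K1LocalisedCascade` (stmt-AnomalousDissipation-19491), route
`SawtoothPulseCascade`, registered line `Cruxes.K1LocalisedCascade.Spectral` (one open stub `stub_highModeConcentration`).
The line count of the analytic first good piece (memo v8 §7–§8) refines a horizontal chord by the FLAT COMPONENTS of the profiles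
`U_j`: with `ζ_j = Mδ_j/(2πN_j)` the component of index `(k, σ)` (`k ∈ ℤ`, `σ = ±1` the slope sign) is the closed interval

  `F_{k,σ} = [ (k − σ/4)/N_j + ζ_j , (k − σ/4 + ½)/N_j − ζ_j ]`

(ascending `σ = 1`: phases `2πN_j y ∈ [−π/2 + 2πk + Mδ_j, π/2 + 2πk − Mδ_j]`; descending `σ = −1`: `[π/2 + 2πk + Mδ_j, 3π/2 + 2πk − Mδ_j]`).
This file proves, for `M ≥ 1`, `Mδ_j < π/2` (`δ₀ > 0`, `d > 0`, `N₀ ≥ 1`, `ρN ≥ 1`):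

* `abs_deriv_U_sub_sign_le_of_mem_component` — `|U_j′ − σ| ≤ 2e^{−M²/2}` on the CLOSED component (closure of `…FlatAffine`'s open-branch bound);
* `abs_U_sub_U_sub_sign_le_of_mem_component` — `|U_j(y) − U_j(y′) − σ(y − y′)| ≤ 2e^{−M²/2}|y − y′|` for `y, y′ ∈ F_{k,σ}`
  (the hypothesis `hUV`/`hUH` of `…K1Start.norm_sub_sub_itinJac_mulVec_le`);
* `rank_sub_rank_le_of_meet` — two components meeting an interval `[u, v]` have ranks `r = 2k + (1 − σ)/2` with
  `r′ − r ≤ 2N_j(v − u) + 1 − 2Mδ_j/π` (so at most `⌊2N_j(v−u) + 1⌋ + 1` components meet it — the straddle-inclusive count of memo v8 §8);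
* `mem_component_or_near_corner` — every `y` lies in some `F_{k,σ}` or within phase distance `Mδ_j` of a corner `π/2 + πm`;
* `volume_cornerZone_le` — the corner zone `{∃ m, |2πN_j y − (π/2 + πm)| < Mδ_j}` read on the circle has volume `≤ 2Mδ_j/π` (the SHARP count:
  `2N_j` corners per period), and is measurable — the per-stage zone of `…K1Start.volume_badSet_le_sum`.

WHAT THIS IS NOT: no statement about the iterate; profile geometry only. [cite: ElgindiLissMattingly2025, §1 (slope ±1 branches and corner strips)]
[problem: turb]
-/

-- `Summit.<Summit>.<Problem>`: single-conjunct summit, the duplicate namespace segment is deliberate.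
set_option linter.dupNamespace false

noncomputable section

namespace Summit.AnomalousDissipation.AnomalousDissipation.Theorems.SawtoothPulseCascade.K1Start

open MeasureTheory Set Filter Topology Function
open scoped ENNReal
open Literature.Analysis Literature.Analysis.FunctionSpaces
open Literature.Analysis.FluidPDE.SawtoothCascade Literature.Analysis.FluidPDE.SawtoothCascade.CascadeParams

variable (P : CascadeParams)

/-! ## §1 Slope and affinity on a closed component -/

/-- **Slope on a closed flat component**: for `z ∈ F_{k,σ}`, `|U_j′(z) − σ| ≤ 2e^{−M²/2}` (`σ = ±1`, `M ≥ 1`, `Mδ_j < π/2`).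
[cite: ElgindiLissMattingly2025, §1 (slope ±1 branches)] -/
theorem abs_deriv_U_sub_sign_le_of_mem_component (hδ₀ : 0 < P.δ₀) (hd : 0 < P.d) (hN₀ : 1 ≤ P.N₀) (hρ : 1 ≤ P.ρN) {j : ℕ}
    {M : ℝ} (hM : 1 ≤ M) (hMδ : M * P.δ j < Real.pi / 2) (k : ℤ) {σ : ℝ} (hσ : σ = 1 ∨ σ = -1) {z : ℝ}
    (hz : z ∈ Icc ((k - σ / 4) / P.N j + M * P.δ j / (2 * Real.pi * P.N j))
      ((k - σ / 4 + 1 / 2) / P.N j - M * P.δ j / (2 * Real.pi * P.N j))) :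
    |deriv (P.U j) z - σ| ≤ 2 * Real.exp (-(M ^ 2 / 2)) := by
  have hπ : 0 < Real.pi := Real.pi_pos
  have hNpos : (0 : ℝ) < P.N j := by exact_mod_cast P.N_pos hN₀ hρ j
  have hc : 0 < 2 * Real.pi * P.N j := by positivity
  have hδ : 0 < P.δ j := P.δ_pos hδ₀ hd j
  set lo : ℝ := (k - σ / 4) / P.N j + M * P.δ j / (2 * Real.pi * P.N j) with hlo
  set hi : ℝ := (k - σ / 4 + 1 / 2) / P.N j - M * P.δ j / (2 * Real.pi * P.N j) with hhi
  have hlohi : lo < hi := by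
    rw [hlo, hhi, div_add_div _ _ hNpos.ne' hc.ne', div_sub_div _ _ hNpos.ne' hc.ne', div_lt_div_iff_of_pos_right (by positivity)]
    nlinarith
  -- the open component carries the bound (FlatAffine); the closed one by continuity of `U_j′`
  have hopen : ∀ w ∈ Ioo lo hi, |deriv (P.U j) w - σ| ≤ 2 * Real.exp (-(M ^ 2 / 2)) := by
    intro w hw
    have h1 : 2 * Real.pi * P.N j * lo = 2 * Real.pi * (k - σ / 4) + M * P.δ j := by
      rw [hlo]; field_simp
    have h2 : 2 * Real.pi * P.N j * hi = 2 * Real.pi * (k - σ / 4 + 1 / 2) - M * P.δ j := by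
      rw [hhi]; field_simp
    have hw1 : 2 * Real.pi * P.N j * lo < 2 * Real.pi * P.N j * w := mul_lt_mul_of_pos_left hw.1 hc
    have hw2 : 2 * Real.pi * P.N j * w < 2 * Real.pi * P.N j * hi := mul_lt_mul_of_pos_left hw.2 hc
    rw [h1] at hw1
    rw [h2] at hw2
    rcases hσ with rfl | rfl
    · exact K1Flat.abs_deriv_U_sub_one_le P hδ (P.N_pos hN₀ hρ j).ne' hM k (by linarith) (by linarith)
    · have := K1Flat.abs_deriv_U_add_one_le P hδ (P.N_pos hN₀ hρ j).ne' hM k (y := w) (by linarith) (by linarith)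
      simpa [sub_neg_eq_add] using this
  have hcont : Continuous (deriv (P.U j)) := (P.contDiff_U hδ (n := 1)).continuous_deriv le_rfl
  have hclosed : IsClosed {w : ℝ | |deriv (P.U j) w - σ| ≤ 2 * Real.exp (-(M ^ 2 / 2))} :=
    isClosed_le ((hcont.sub continuous_const).abs) continuous_const
  have hsub : Icc lo hi ⊆ {w : ℝ | |deriv (P.U j) w - σ| ≤ 2 * Real.exp (-(M ^ 2 / 2))} := by
    rw [← closure_Ioo hlohi.ne]
    exact hclosed.closure_subset_iff.mpr hopen
  exact hsub hz

/-- **Affine on a closed flat component**: for `y, y′ ∈ F_{k,σ}`, `|U_j(y) − U_j(y′) − σ(y − y′)| ≤ 2e^{−M²/2}|y − y′|`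
(mean value theorem). [cite: ElgindiLissMattingly2025, §1 (slope ±1 branches)] -/
theorem abs_U_sub_U_sub_sign_le_of_mem_component (hδ₀ : 0 < P.δ₀) (hd : 0 < P.d) (hN₀ : 1 ≤ P.N₀) (hρ : 1 ≤ P.ρN) {j : ℕ}
    {M : ℝ} (hM : 1 ≤ M) (hMδ : M * P.δ j < Real.pi / 2) (k : ℤ) {σ : ℝ} (hσ : σ = 1 ∨ σ = -1) {y y' : ℝ}
    (hy : y ∈ Icc ((k - σ / 4) / P.N j + M * P.δ j / (2 * Real.pi * P.N j))
      ((k - σ / 4 + 1 / 2) / P.N j - M * P.δ j / (2 * Real.pi * P.N j)))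
    (hy' : y' ∈ Icc ((k - σ / 4) / P.N j + M * P.δ j / (2 * Real.pi * P.N j))
      ((k - σ / 4 + 1 / 2) / P.N j - M * P.δ j / (2 * Real.pi * P.N j))) :
    |P.U j y - P.U j y' - σ * (y - y')| ≤ 2 * Real.exp (-(M ^ 2 / 2)) * |y - y'| := by
  have hdiff : Differentiable ℝ (P.U j) := (P.contDiff_U (P.δ_pos hδ₀ hd j) (n := 1)).differentiable one_ne_zero
  have hf : ∀ z ∈ Icc ((k - σ / 4) / P.N j + M * P.δ j / (2 * Real.pi * P.N j))
      ((k - σ / 4 + 1 / 2) / P.N j - M * P.δ j / (2 * Real.pi * P.N j)), DifferentiableAt ℝ (fun z => P.U j z - σ * z) z :=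
    fun z _ => (hdiff z).sub (differentiableAt_id.const_mul σ)
  have hbound : ∀ z ∈ Icc ((k - σ / 4) / P.N j + M * P.δ j / (2 * Real.pi * P.N j))
      ((k - σ / 4 + 1 / 2) / P.N j - M * P.δ j / (2 * Real.pi * P.N j)),
      ‖deriv (fun z => P.U j z - σ * z) z‖ ≤ 2 * Real.exp (-(M ^ 2 / 2)) := fun z hz => by
    have hd' : deriv (fun z => P.U j z - σ * z) z = deriv (P.U j) z - σ := by
      have h := ((hdiff z).hasDerivAt.sub ((hasDerivAt_id z).const_mul σ)).deriv
      rw [mul_one] at h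
      exact h
    rw [hd', Real.norm_eq_abs]
    exact abs_deriv_U_sub_sign_le_of_mem_component P hδ₀ hd hN₀ hρ hM hMδ k hσ hz
  have h := (convex_Icc _ _).norm_image_sub_le_of_norm_deriv_le hf hbound hy' hy
  rw [Real.norm_eq_abs, Real.norm_eq_abs] at h
  rw [show P.U j y - P.U j y' - σ * (y - y') = (P.U j y - σ * y) - (P.U j y' - σ * y') by ring]
  exact h

/-! ## §2 Counting the components that meet an interval -/

/-- **The straddle-inclusive count.**  If the components `(k, σ)` and `(k′, σ′)` both meet `[u, v]`, then their ranks
`r = 2k + (1−σ)/2`, `r′` satisfy `r′ − r ≤ 2N_j(v − u) + 1 − 2Mδ_j/π` (hence at most `⌊2N_j(v−u)+1⌋ + 1` components meet `[u, v]`).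
[cite: ElgindiLissMattingly2025, §1 (corner strips)] -/
theorem rank_sub_rank_le_of_meet (hN₀ : 1 ≤ P.N₀) (hρ : 1 ≤ P.ρN) {j : ℕ} {M : ℝ} (k k' : ℤ) {σ σ' u v : ℝ}
    (hmeet : ∃ y ∈ Icc u v, y ∈ Icc ((k - σ / 4) / P.N j + M * P.δ j / (2 * Real.pi * P.N j))
      ((k - σ / 4 + 1 / 2) / P.N j - M * P.δ j / (2 * Real.pi * P.N j)))
    (hmeet' : ∃ y ∈ Icc u v, y ∈ Icc ((k' - σ' / 4) / P.N j + M * P.δ j / (2 * Real.pi * P.N j))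
      ((k' - σ' / 4 + 1 / 2) / P.N j - M * P.δ j / (2 * Real.pi * P.N j))) :
    (2 * k' + (1 - σ') / 2) - (2 * k + (1 - σ) / 2) ≤ 2 * P.N j * (v - u) + 1 - 2 * M * P.δ j / Real.pi := by
  have hπ : 0 < Real.pi := Real.pi_pos
  have hNpos : (0 : ℝ) < P.N j := by exact_mod_cast P.N_pos hN₀ hρ j
  obtain ⟨y, ⟨_, hyv⟩, _, hyhi⟩ := hmeet
  obtain ⟨y', ⟨hyu', _⟩, hylo', _⟩ := hmeet'
  -- `lo' ≤ v` and `hi ≥ u`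
  have h1 : (k' - σ' / 4) / P.N j + M * P.δ j / (2 * Real.pi * P.N j) ≤ v := hylo'.trans (by linarith)
  have h2 : u ≤ (k - σ / 4 + 1 / 2) / P.N j - M * P.δ j / (2 * Real.pi * P.N j) := by linarith
  have h3 : (k' - σ' / 4) / P.N j + M * P.δ j / (2 * Real.pi * P.N j) -
      ((k - σ / 4 + 1 / 2) / P.N j - M * P.δ j / (2 * Real.pi * P.N j)) ≤ v - u := by linarith
  have e : (k' - σ' / 4) / P.N j + M * P.δ j / (2 * Real.pi * P.N j) -
      ((k - σ / 4 + 1 / 2) / P.N j - M * P.δ j / (2 * Real.pi * P.N j)) =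
      (((2 * k' + (1 - σ') / 2) - (2 * k + (1 - σ) / 2)) - 1 + 2 * M * P.δ j / Real.pi) / (2 * P.N j) := by
    field_simp
    ring
  rw [e, div_le_iff₀ (by positivity)] at h3
  linarith

/-! ## §3 Every point is in a component or in a corner zone -/

/-- **Coverage.**  Every `y ∈ ℝ` lies in some closed component `F_{k,σ}` (`σ = ±1`) or within phase distance `Mδ_j` of a corner:
`∃ m, |2πN_j y − (π/2 + πm)| ≤ Mδ_j` (`…K1Flat.flat_or_near_corner`). [cite: ElgindiLissMattingly2025, §1 (corner strips)] -/
theorem mem_component_or_near_corner (hN₀ : 1 ≤ P.N₀) (hρ : 1 ≤ P.ρN) {j : ℕ} (M y : ℝ) :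
    (∃ (k : ℤ) (σ : ℝ), (σ = 1 ∨ σ = -1) ∧ y ∈ Icc ((k - σ / 4) / P.N j + M * P.δ j / (2 * Real.pi * P.N j))
        ((k - σ / 4 + 1 / 2) / P.N j - M * P.δ j / (2 * Real.pi * P.N j))) ∨
      ∃ m : ℤ, |2 * Real.pi * P.N j * y - (Real.pi / 2 + Real.pi * m)| ≤ M * P.δ j := by
  have hπ : 0 < Real.pi := Real.pi_pos
  have hNpos : (0 : ℝ) < P.N j := by exact_mod_cast P.N_pos hN₀ hρ j
  have hc : 0 < 2 * Real.pi * P.N j := by positivity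
  -- the endpoints of the components in phase units
  have elo : ∀ (k : ℤ) (σ : ℝ), 2 * Real.pi * P.N j * ((k - σ / 4) / P.N j + M * P.δ j / (2 * Real.pi * P.N j)) =
      2 * Real.pi * (k - σ / 4) + M * P.δ j := fun k σ => by field_simp
  have ehi : ∀ (k : ℤ) (σ : ℝ), 2 * Real.pi * P.N j * ((k - σ / 4 + 1 / 2) / P.N j - M * P.δ j / (2 * Real.pi * P.N j)) =
      2 * Real.pi * (k - σ / 4 + 1 / 2) - M * P.δ j := fun k σ => by field_simp
  rcases K1Flat.flat_or_near_corner (2 * Real.pi * P.N j * y) (M * P.δ j) with h | ⟨k, h1, h2⟩ | ⟨k, h1, h2⟩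
  · exact Or.inr h
  · refine Or.inl ⟨k, 1, Or.inl rfl, ?_, ?_⟩
    · rw [← mul_le_mul_iff_of_pos_left hc, elo]; linarith
    · rw [← mul_le_mul_iff_of_pos_left hc, ehi]; linarith
  · refine Or.inl ⟨k, -1, Or.inr rfl, ?_, ?_⟩
    · rw [← mul_le_mul_iff_of_pos_left hc, elo]; linarith
    · rw [← mul_le_mul_iff_of_pos_left hc, ehi]; linarith

/-! ## §4 The corner zone on the circle: `2N_j` arcs of length `Mδ_j/(πN_j)` -/

/-- The corner arcs lie strictly inside the fundamental domain: for `0 ≤ m < 2N_j` and `Mδ_j < π/2`,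
`0 < c_m − ζ_j` and `c_m + ζ_j < 1` with `c_m = (1/4 + m/2)/N_j`, `ζ_j = Mδ_j/(2πN_j)`. [folklore] -/
theorem cornerArc_subset_Ioo (hδ₀ : 0 < P.δ₀) (hd : 0 < P.d) (hN₀ : 1 ≤ P.N₀) (hρ : 1 ≤ P.ρN) {j : ℕ} {M : ℝ}
    (hM : 0 ≤ M) (hMδ : M * P.δ j < Real.pi / 2) {m : ℕ} (hm : m < 2 * P.N j) :
    0 < (1 / 4 + (m : ℝ) / 2) / P.N j - M * P.δ j / (2 * Real.pi * P.N j) ∧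
      (1 / 4 + (m : ℝ) / 2) / P.N j + M * P.δ j / (2 * Real.pi * P.N j) < 1 := by
  have hπ : 0 < Real.pi := Real.pi_pos
  have hNpos : (0 : ℝ) < P.N j := by exact_mod_cast P.N_pos hN₀ hρ j
  have hc : 0 < 2 * Real.pi * P.N j := by positivity
  have hδ : 0 < P.δ j := P.δ_pos hδ₀ hd j
  have hm' : (m : ℝ) + 1 ≤ 2 * P.N j := by exact_mod_cast hm
  have hMδ0 : 0 ≤ M * P.δ j := mul_nonneg hM hδ.le
  constructor
  · rw [div_sub_div _ _ hNpos.ne' hc.ne', lt_div_iff₀ (by positivity), zero_mul]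
    nlinarith [mul_nonneg (Nat.cast_nonneg m) hπ.le]
  · rw [div_add_div _ _ hNpos.ne' hc.ne', div_lt_one (by positivity)]
    nlinarith

/-- **The corner zone is covered by the `2N_j` corner arcs of the fundamental domain.**  If `|2πN_j y − (π/2 + πm)| ≤ Mδ_j` for some
`m ∈ ℤ`, then the class of `y` in `𝕋 = ℝ/ℤ` lies in `⋃_{m' < 2N_j} mk '' [c_{m'} − ζ_j, c_{m'} + ζ_j]` (reduce `m` modulo `2N_j`).
[cite: ElgindiLissMattingly2025, §1 (corner strips)] -/
theorem coe_mem_cornerArcs (hN₀ : 1 ≤ P.N₀) (hρ : 1 ≤ P.ρN) {j : ℕ} {M y : ℝ}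
    (hy : ∃ m : ℤ, |2 * Real.pi * P.N j * y - (Real.pi / 2 + Real.pi * m)| ≤ M * P.δ j) :
    (y : UnitAddCircle) ∈ ⋃ m ∈ Finset.range (2 * P.N j), (QuotientAddGroup.mk : ℝ → UnitAddCircle) ''
      Icc ((1 / 4 + (m : ℝ) / 2) / P.N j - M * P.δ j / (2 * Real.pi * P.N j))
        ((1 / 4 + (m : ℝ) / 2) / P.N j + M * P.δ j / (2 * Real.pi * P.N j)) := by
  have hπ : 0 < Real.pi := Real.pi_pos
  have hNposN : 0 < P.N j := P.N_pos hN₀ hρ j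
  have hNpos : (0 : ℝ) < P.N j := by exact_mod_cast hNposN
  have hc : 0 < 2 * Real.pi * P.N j := by positivity
  obtain ⟨m, hm⟩ := hy
  -- reduce the corner index modulo `2N_j`: `m = 2N n + m₀`
  set L : ℤ := 2 * (P.N j : ℤ) with hL
  have hLpos : 0 < L := by rw [hL]; exact_mod_cast Nat.mul_pos two_pos hNposN
  set n : ℤ := m / L with hn
  set m₀ : ℤ := m % L with hm₀
  have hm₀0 : 0 ≤ m₀ := Int.emod_nonneg _ hLpos.ne'
  have hm₀L : m₀ < L := Int.emod_lt_of_pos _ hLpos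
  have hdecomp : (m : ℝ) = L * n + m₀ := by
    have h := Int.mul_ediv_add_emod m L
    have h' : (m : ℝ) = ((L * (m / L) + m % L : ℤ) : ℝ) := by rw [h]
    rw [h']; push_cast; rw [hn, hm₀]
  -- the natural representative
  obtain ⟨m', hm'⟩ : ∃ m' : ℕ, (m' : ℤ) = m₀ := ⟨m₀.toNat, Int.toNat_of_nonneg hm₀0⟩
  have hm'lt : m' < 2 * P.N j := by
    have : (m' : ℤ) < L := hm' ▸ hm₀L
    rw [hL] at this; exact_mod_cast this
  refine mem_iUnion₂.mpr ⟨m', Finset.mem_range.mpr hm'lt, ?_⟩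
  -- `y − n` is a lift of the class of `y` inside the arc `m'`
  refine ⟨y - n, ?_, ?_⟩
  · have hLr : (L : ℝ) = 2 * P.N j := by rw [hL]; push_cast; ring
    have hm₀r : (m₀ : ℝ) = m' := by rw [← hm']; push_cast; ring
    rw [abs_le] at hm
    obtain ⟨hm1, hm2⟩ := hm
    rw [hdecomp, hLr, hm₀r] at hm1 hm2
    constructor
    · rw [← mul_le_mul_iff_of_pos_left hc]
      have e : 2 * Real.pi * P.N j * ((1 / 4 + (m' : ℝ) / 2) / P.N j - M * P.δ j / (2 * Real.pi * P.N j)) =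
          Real.pi / 2 + Real.pi * m' - M * P.δ j := by field_simp; ring
      rw [e]
      have e2 : 2 * Real.pi * P.N j * (y - n) = 2 * Real.pi * P.N j * y - Real.pi * (2 * P.N j * n) := by ring
      rw [e2]; linarith
    · rw [← mul_le_mul_iff_of_pos_left hc]
      have e : 2 * Real.pi * P.N j * ((1 / 4 + (m' : ℝ) / 2) / P.N j + M * P.δ j / (2 * Real.pi * P.N j)) =
          Real.pi / 2 + Real.pi * m' + M * P.δ j := by field_simp; ring
      rw [e]
      have e2 : 2 * Real.pi * P.N j * (y - n) = 2 * Real.pi * P.N j * y - Real.pi * (2 * P.N j * n) := by ring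
      rw [e2]; linarith
  · rw [QuotientAddGroup.mk_sub]
    have h0 : ((n : ℝ) : UnitAddCircle) = 0 := (AddCircle.coe_eq_zero_iff (p := (1 : ℝ))).mpr ⟨n, by simp⟩
    rw [h0, sub_zero]

/-- **Volume of the corner zone on the circle**: the union of the `2N_j` corner arcs has volume `≤ 2Mδ_j/π` (each arc lies inside the
fundamental domain `(0,1)` and lifts to an interval of length `Mδ_j/(πN_j)`), and it is measurable. [cite: ElgindiLissMattingly2025, §1] -/
theorem volume_cornerArcs_le (hδ₀ : 0 < P.δ₀) (hd : 0 < P.d) (hN₀ : 1 ≤ P.N₀) (hρ : 1 ≤ P.ρN) {j : ℕ} {M : ℝ}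
    (hM : 1 ≤ M) (hMδ : M * P.δ j < Real.pi / 2) :
    MeasurableSet (⋃ m ∈ Finset.range (2 * P.N j), (QuotientAddGroup.mk : ℝ → UnitAddCircle) ''
      Icc ((1 / 4 + (m : ℝ) / 2) / P.N j - M * P.δ j / (2 * Real.pi * P.N j))
        ((1 / 4 + (m : ℝ) / 2) / P.N j + M * P.δ j / (2 * Real.pi * P.N j))) ∧
    volume (⋃ m ∈ Finset.range (2 * P.N j), (QuotientAddGroup.mk : ℝ → UnitAddCircle) ''
      Icc ((1 / 4 + (m : ℝ) / 2) / P.N j - M * P.δ j / (2 * Real.pi * P.N j))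
        ((1 / 4 + (m : ℝ) / 2) / P.N j + M * P.δ j / (2 * Real.pi * P.N j))) ≤ ENNReal.ofReal (2 * M * P.δ j / Real.pi) := by
  have hπ : 0 < Real.pi := Real.pi_pos
  have hNpos : (0 : ℝ) < P.N j := by exact_mod_cast P.N_pos hN₀ hρ j
  have hc : 0 < 2 * Real.pi * P.N j := by positivity
  have hδ : 0 < P.δ j := P.δ_pos hδ₀ hd j
  -- each arc: measurable (compact image) and of volume `≤` its length
  have harc : ∀ m ∈ Finset.range (2 * P.N j),
      MeasurableSet ((QuotientAddGroup.mk : ℝ → UnitAddCircle) ''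
        Icc ((1 / 4 + (m : ℝ) / 2) / P.N j - M * P.δ j / (2 * Real.pi * P.N j))
          ((1 / 4 + (m : ℝ) / 2) / P.N j + M * P.δ j / (2 * Real.pi * P.N j))) ∧
      volume ((QuotientAddGroup.mk : ℝ → UnitAddCircle) ''
        Icc ((1 / 4 + (m : ℝ) / 2) / P.N j - M * P.δ j / (2 * Real.pi * P.N j))
          ((1 / 4 + (m : ℝ) / 2) / P.N j + M * P.δ j / (2 * Real.pi * P.N j))) ≤
        ENNReal.ofReal (M * P.δ j / (Real.pi * P.N j)) := by
    intro m hm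
    set a : ℝ := (1 / 4 + (m : ℝ) / 2) / P.N j - M * P.δ j / (2 * Real.pi * P.N j) with ha
    set b : ℝ := (1 / 4 + (m : ℝ) / 2) / P.N j + M * P.δ j / (2 * Real.pi * P.N j) with hb
    obtain ⟨ha0, hb1⟩ := cornerArc_subset_Ioo P hδ₀ hd hN₀ hρ (zero_le_one.trans hM) hMδ (Finset.mem_range.mp hm)
    have hcmk : Continuous (QuotientAddGroup.mk : ℝ → UnitAddCircle) := continuous_quotient_mk'
    have hmeas : MeasurableSet ((QuotientAddGroup.mk : ℝ → UnitAddCircle) '' Icc a b) :=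
      ((isCompact_Icc (a := a) (b := b)).image hcmk).isClosed.measurableSet
    refine ⟨hmeas, ?_⟩
    have hproj := AddCircle.add_projection_respects_measure (T := (1 : ℝ)) 0 hmeas
    rw [zero_add] at hproj
    -- the preimage of the arc inside `(0,1]` is the interval itself
    have hpre : (QuotientAddGroup.mk : ℝ → UnitAddCircle) ⁻¹' ((QuotientAddGroup.mk : ℝ → UnitAddCircle) '' Icc a b) ∩
        Ioc (0 : ℝ) 1 ⊆ Icc a b := by
      rintro y ⟨⟨y', hy', hyy'⟩, hy0, hy1⟩
      have hy'I : y' ∈ Ico (0 : ℝ) (0 + 1) := ⟨ha0.le.trans hy'.1, by linarith [hy'.2]⟩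
      rcases hy1.lt_or_eq with hlt | heq
      · have hyI : y ∈ Ico (0 : ℝ) (0 + 1) := ⟨hy0.le, by linarith⟩
        have := (AddCircle.coe_eq_coe_iff_of_mem_Ico hy'I hyI).mp hyy'
        rw [← this]; exact hy'
      · exfalso
        have h1 : ((1 : ℝ) : UnitAddCircle) = ((0 : ℝ) : UnitAddCircle) := by
          rw [AddCircle.coe_period]; simp
        rw [heq, h1] at hyy'
        have h0I : (0 : ℝ) ∈ Ico (0 : ℝ) (0 + 1) := ⟨le_rfl, by norm_num⟩
        have := (AddCircle.coe_eq_coe_iff_of_mem_Ico hy'I h0I).mp hyy'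
        rw [this] at hy'
        exact absurd hy'.1 (not_le.mpr ha0)
    calc volume ((QuotientAddGroup.mk : ℝ → UnitAddCircle) '' Icc a b)
        = volume ((QuotientAddGroup.mk : ℝ → UnitAddCircle) ⁻¹' ((QuotientAddGroup.mk : ℝ → UnitAddCircle) '' Icc a b) ∩
            Ioc (0 : ℝ) 1) := hproj
      _ ≤ volume (Icc a b) := measure_mono hpre
      _ = ENNReal.ofReal (M * P.δ j / (Real.pi * P.N j)) := by
          rw [Real.volume_Icc]; congr 1; rw [ha, hb]; field_simp; ring
  refine ⟨Finset.measurableSet_biUnion _ fun m hm => (harc m hm).1, ?_⟩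
  refine (measure_biUnion_finset_le _ _).trans ?_
  calc ∑ m ∈ Finset.range (2 * P.N j), volume ((QuotientAddGroup.mk : ℝ → UnitAddCircle) ''
          Icc ((1 / 4 + (m : ℝ) / 2) / P.N j - M * P.δ j / (2 * Real.pi * P.N j))
            ((1 / 4 + (m : ℝ) / 2) / P.N j + M * P.δ j / (2 * Real.pi * P.N j)))
      ≤ ∑ m ∈ Finset.range (2 * P.N j), ENNReal.ofReal (M * P.δ j / (Real.pi * P.N j)) :=
        Finset.sum_le_sum fun m hm => (harc m hm).2
    _ = ENNReal.ofReal (2 * M * P.δ j / Real.pi) := by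
        rw [Finset.sum_const, Finset.card_range, nsmul_eq_mul, ← ENNReal.ofReal_natCast, ← ENNReal.ofReal_mul (by positivity)]
        congr 1; push_cast; field_simp

end Summit.AnomalousDissipation.AnomalousDissipation.Theorems.SawtoothPulseCascade.K1Start
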